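import Mathlib.Analysis.InnerProductSpace.PiL2
import Mathlib.Analysis.InnerProductSpace.Projection.FiniteDimensional
import Mathlib.Analysis.Calculus.ContDiff.Operations
import Mathlib.Analysis.Normed.Module.FiniteDimension
import Mathlib.Geometry.Manifold.SmoothApprox
import Mathlib.Geometry.Manifold.ContMDiff.NormedSpace
import Mathlib.Topology.Algebra.Module.FiniteDimension
import HarnessLib

/-!
# Frames complementary to a family of planes: lifting and smoothing

Topic `Literature/Topology/FourManifolds` (fact seat
`provefact-Literature.Topology.FourManifolds.exists-b806fed4e8`). First of two files
(`ComplementaryFrames.lean`, `ComplementaryFramesPeel.lean`) formalising, in the language of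
frames and without vector bundles, the destabilisation lemma behind Kervaire–Milnor's Lemma 3.3
(*Groups of homotopy spheres I* (1963), p. 509):

> LEMMA 3.5. *Let `ξ` be a `k`-dimensional vector space bundle over an `n`-dimensional complex,
> `k > n`. If the Whitney sum of `ξ` with a trivial bundle `εʳ` is trivial then `ξ` itself is
> trivial.*
>
> PROOF OF LEMMA 3.3. *Let `τ`, `ν` denote the tangent and normal bundles of `M`. Then `τ ⊕ ν` is
> trivial hence `(τ ⊕ ε¹) ⊕ ν` is trivial. Applying Lemma 3.5 the conclusion follows.*

The setting (used for `ν` = the normal bundle of an s-parallelizable `Mⁿ ⊆ Sⁿ⁺ᵏ`, where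
`τ ⊕ ε¹ = T x := dι(T_x M) ⊕ ℝ x ⊆ V = ℝⁿ⁺ᵏ⁺¹` is framed *continuously* by hypothesis): a compact
manifold `M`, a finite-dimensional inner product space `V`, subspaces `T x ⊆ V`, and *frames*
`Φ : C →L[ℝ] W` into `W = V × ℝʲ` ("level `j`") **complementary** to `T x × 0`
(`Literature.Topology.FourManifolds.IsComplementary`: no nonzero value of `Φ` lies in the
subspace; for complementary dimensions, `W = (T x × 0) ⊕ Φ(C)`). A smooth family of frames
complementary to `T x × 0` at level `j` is a framing of `ν ⊕ εʲ`; this file produces one at level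
`m = dim T x` from a continuous frame of `T` (the triviality of `(τ ⊕ ε¹) ⊕ ν`, made smooth), and
`ComplementaryFramesPeel.lean` lowers the level one step at a time (Lemma 3.5).

## Main results (all proved)

* `IsComplementary` and its linear algebra: `injective`, `disjoint`, `comp`, `eq_of_sub_mem`
  (uniqueness of coefficients), `sup_range_eq_top` / `exists_eq_add` (decomposition for
  complementary dimensions), `bijective_coprod` (a complementary frame completes frames of `T` to
  bases), `isComplementary_iff_linearIndependent` and `isOpen_setOf_isComplementary`
  (complementarity is an open condition).
* `exists_contMDiffOn_coeff` — coefficients of a fixed vector along a smoothly moving basis are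
  smooth (inversion of continuous linear maps is smooth, `contDiffAt_map_inverse`).
* `gramMap`, `liftFrame`, `isComplementary_liftFrame_gramMap` — **lift**: if `σ₀, …, σ_{m-1}`
  span `T`, the graph of the Gram map `v ↦ (v, (⟪σ_l, v⟫)_l)` is complementary to `T × 0` in
  `V × ℝᵐ`.
* `exists_contMDiff_isComplementary_liftFrame` — **smoothing**: for a continuous pointwise
  independent frame `σ` of `x ↦ T x` over a compact manifold there is a *smooth* `x ↦ L x` whose
  graphs are complementary to `T x × 0` (openness + compactness via `generalized_tube_lemma` +
  Mathlib's smooth approximation `Continuous.exists_contMDiff_approx`).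

## References

* M. Kervaire, J. Milnor, *Groups of homotopy spheres I*, Ann. of Math. 77 (1963), §3,
  Lemmas 3.3–3.5 (p. 509). [KervaireMilnorAnnals1963]
* A. Kosinski, *Differential Manifolds* (1993), IX §2 (framings of `ν ⊕ εʲ`, framed
  submanifolds). [Kosinski1993]
-/

open scoped Manifold ContDiff Topology RealInnerProductSpace
open Set Function Module Filter

noncomputable section

namespace Literature.Topology.FourManifolds

/-! ### Frames complementary to a subspace -/

section LinearAlgebra

variable {W : Type*} [NormedAddCommGroup W] [NormedSpace ℝ W]
  {C : Type*} [NormedAddCommGroup C] [NormedSpace ℝ C]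
  {C' : Type*} [NormedAddCommGroup C'] [NormedSpace ℝ C']

/-- A continuous linear map `Φ : C → W` (a *frame* parametrised by `C`) is **complementary** to
the subspace `T ⊆ W` if no nonzero value of `Φ` lies in `T`; equivalently `Φ` is injective and
its range meets `T` trivially, i.e. the vectors `Φ(eᵢ)` are linearly independent modulo `T`
(for `dim T + dim C = dim W`: `W = T ⊕ Φ(C)`). With `T` the tangent space of a submanifold this
is a frame of a complement of the tangent bundle, e.g. of the normal bundle (Kervaire–Milnor
1963, §3; Kosinski, *Differential Manifolds*, IX §2). [folklore] -/
def IsComplementary (T : Submodule ℝ W) (Φ : C →L[ℝ] W) : Prop :=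
  ∀ a : C, Φ a ∈ T → a = 0

namespace IsComplementary

variable {T T' : Submodule ℝ W} {Φ : C →L[ℝ] W}

/-- A complementary frame is injective. [folklore] -/
theorem injective (h : IsComplementary T Φ) : Injective Φ :=
  (injective_iff_map_eq_zero _).2 fun a ha => h a (ha ▸ T.zero_mem)

/-- The range of a complementary frame meets the subspace trivially. [folklore] -/
theorem disjoint (h : IsComplementary T Φ) : Disjoint T (LinearMap.range (Φ : C →ₗ[ℝ] W)) := by
  rw [Submodule.disjoint_def]
  rintro w hwT ⟨a, rfl⟩
  rw [h a hwT, map_zero]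

/-- Injectivity plus disjointness from `T` is complementarity. [folklore] -/
theorem of_injective_of_disjoint (hinj : Injective Φ)
    (hdis : Disjoint T (LinearMap.range (Φ : C →ₗ[ℝ] W))) : IsComplementary T Φ := fun a ha => by
  rw [Submodule.disjoint_def] at hdis
  have := hdis (Φ a) ha ⟨a, rfl⟩
  exact (injective_iff_map_eq_zero _).1 hinj a this

/-- Complementarity is inherited by smaller subspaces. [folklore] -/
theorem mono (h : IsComplementary T Φ) (hle : T' ≤ T) : IsComplementary T' Φ :=
  fun a ha => h a (hle ha)

/-- Precomposition with an injective map preserves complementarity. [folklore] -/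
theorem comp (h : IsComplementary T Φ) {G : C' →L[ℝ] C} (hG : Injective G) :
    IsComplementary T (Φ.comp G) := fun b hb =>
  (injective_iff_map_eq_zero _).1 hG b (h (G b) hb)

/-- Coefficients with respect to a complementary frame are unique modulo `T`. [folklore] -/
theorem eq_of_sub_mem (h : IsComplementary T Φ) {c c' : C} (hc : Φ c - Φ c' ∈ T) : c = c' := by
  rw [← map_sub] at hc
  exact sub_eq_zero.mp (h _ hc)

/-- A complementary frame together with `T` spans everything when the dimensions add up.
[folklore] -/
theorem sup_range_eq_top [FiniteDimensional ℝ W] (h : IsComplementary T Φ)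
    (hdim : finrank ℝ T + finrank ℝ C = finrank ℝ W) :
    T ⊔ LinearMap.range (Φ : C →ₗ[ℝ] W) = ⊤ := by
  haveI : FiniteDimensional ℝ C := Module.Finite.of_injective (Φ : C →ₗ[ℝ] W) h.injective
  apply Submodule.eq_top_of_finrank_eq
  have h1 := Submodule.finrank_sup_add_finrank_inf_eq T (LinearMap.range (Φ : C →ₗ[ℝ] W))
  rw [h.disjoint.eq_bot, finrank_bot, add_zero, LinearMap.finrank_range_of_inj h.injective] at h1
  rw [h1, hdim]

/-- Decomposition along a complementary frame of complementary dimension: every vector is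
`t + Φ c` with `t ∈ T`. [folklore] -/
theorem exists_eq_add [FiniteDimensional ℝ W] (h : IsComplementary T Φ)
    (hdim : finrank ℝ T + finrank ℝ C = finrank ℝ W) (e : W) :
    ∃ t ∈ T, ∃ c : C, e = t + Φ c := by
  have he : e ∈ T ⊔ LinearMap.range (Φ : C →ₗ[ℝ] W) := by
    rw [h.sup_range_eq_top hdim]; exact Submodule.mem_top
  obtain ⟨t, ht, y, ⟨c, rfl⟩, rfl⟩ := Submodule.mem_sup.mp he
  exact ⟨t, ht, c, rfl⟩

end IsComplementary

/-- **Complementarity as linear independence of a family**: if `s` is a basis family of `T` and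
`b` a basis of `C`, then `Φ` is complementary to `T` iff the family `(s, Φ ∘ b)` is linearly
independent. [folklore] -/
theorem isComplementary_iff_linearIndependent {ι κ : Type*} [Fintype κ] {T : Submodule ℝ W}
    {s : ι → W} (hs : LinearIndependent ℝ s) (hsT : Submodule.span ℝ (range s) = T)
    (b : Basis κ ℝ C) (Φ : C →L[ℝ] W) :
    IsComplementary T Φ ↔ LinearIndependent ℝ (Sum.elim s (fun i => Φ (b i))) := by
  have hrange : Submodule.span ℝ (range fun i => Φ (b i)) = LinearMap.range (Φ : C →ₗ[ℝ] W) := by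
    rw [show (fun i => Φ (b i)) = (Φ : C →ₗ[ℝ] W) ∘ b from rfl, Set.range_comp,
      Submodule.span_image, b.span_eq, Submodule.map_top]
  rw [linearIndependent_sum, Sum.elim_comp_inl, Sum.elim_comp_inr, hsT, hrange]
  constructor
  · intro h
    exact ⟨hs, b.linearIndependent.map' _ (LinearMap.ker_eq_bot.mpr h.injective), h.disjoint⟩
  · rintro ⟨-, hli, hdis⟩
    refine IsComplementary.of_injective_of_disjoint ((injective_iff_map_eq_zero _).2 fun a ha => ?_)
      hdis
    have hsum : ∑ i, b.equivFun a i • Φ (b i) = 0 := by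
      have := congrArg Φ (b.sum_equivFun a)
      rw [map_sum] at this
      simp only [map_smul] at this
      rw [this, ha]
    have hzero := Fintype.linearIndependent_iff.mp hli _ hsum
    rw [← b.sum_equivFun a]
    simp [hzero]

/-- **Complementarity is an open condition**: for a continuously framed family of subspaces
`T x = span (s · x)` and a continuous family of frames `Φ x`, the set of `x` at which `Φ x` is
complementary to `T x` is open (linear independence of a continuous family of vectors is an open
condition, `isOpen_setOf_linearIndependent`). [folklore] -/
theorem isOpen_setOf_isComplementary {X : Type*} [TopologicalSpace X] {ι κ : Type*} [Fintype ι]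
    [Fintype κ] [CompleteSpace W] {T : X → Submodule ℝ W} {s : ι → X → W}
    (hsc : ∀ i, Continuous (s i)) (hs : ∀ x, LinearIndependent ℝ fun i => s i x)
    (hsT : ∀ x, Submodule.span ℝ (range fun i => s i x) = T x) (b : Basis κ ℝ C)
    {Φ : X → (C →L[ℝ] W)} (hΦ : Continuous Φ) :
    IsOpen {x | IsComplementary (T x) (Φ x)} := by
  have heq : {x | IsComplementary (T x) (Φ x)} =
      (fun x => Sum.elim (fun i => s i x) (fun i => Φ x (b i))) ⁻¹'
        {f : ι ⊕ κ → W | LinearIndependent ℝ f} := by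
    ext x
    exact isComplementary_iff_linearIndependent (hs x) (hsT x) b (Φ x)
  rw [heq]
  refine isOpen_setOf_linearIndependent.preimage (continuous_pi fun j => ?_)
  rcases j with i | i
  · exact hsc i
  · exact (ContinuousLinearMap.apply ℝ W (b i)).continuous.comp hΦ

end LinearAlgebra

/-! ### Smooth dependence of coefficients on a moving frame -/

section Coefficients

variable {EM : Type*} [NormedAddCommGroup EM] [NormedSpace ℝ EM] {HM : Type*} [TopologicalSpace HM]
  {I : ModelWithCorners ℝ EM HM} {M : Type*} [TopologicalSpace M] [ChartedSpace HM M]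
  {W : Type*} [NormedAddCommGroup W] [NormedSpace ℝ W]
  {C : Type*} [NormedAddCommGroup C] [NormedSpace ℝ C] [FiniteDimensional ℝ C]
  {Em : Type*} [NormedAddCommGroup Em] [NormedSpace ℝ Em] [FiniteDimensional ℝ Em]

/-- A bijective continuous linear map from a finite-dimensional space is invertible (its inverse
is automatically continuous). [folklore] -/
theorem isInvertible_of_bijective (f : Em →L[ℝ] W) (hf : Bijective f) : f.IsInvertible := by
  haveI : FiniteDimensional ℝ W := Module.Finite.of_surjective (f : Em →ₗ[ℝ] W) hf.2
  exact ⟨(LinearEquiv.ofBijective (f : Em →ₗ[ℝ] W) hf).toContinuousLinearEquiv, by ext; rfl⟩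

/-- **Coefficients along a smoothly moving basis are smooth.** If `B x : Em → W` and
`Φ x : C → W` depend smoothly on `x ∈ U` and together form an isomorphism `Em × C ≅ W` at every
`x ∈ U`, then the `C`-coefficient of a fixed vector `e` — the `c x` with `e = B x y + Φ x (c x)` —
depends smoothly on `x` (inversion of continuous linear maps is smooth). [folklore] -/
theorem exists_contMDiffOn_coeff {U : Set M} {B : M → (Em →L[ℝ] W)}
    (hB : ContMDiffOn I 𝓘(ℝ, Em →L[ℝ] W) ∞ B U) {Φ : M → (C →L[ℝ] W)}
    (hΦ : ContMDiffOn I 𝓘(ℝ, C →L[ℝ] W) ∞ Φ U)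
    (hbij : ∀ x ∈ U, Bijective fun p : Em × C => B x p.1 + Φ x p.2) (e : W) :
    ∃ c : M → C, ContMDiffOn I 𝓘(ℝ, C) ∞ c U ∧ ∀ x ∈ U, ∃ y : Em, B x y + Φ x (c x) = e := by
  haveI : CompleteSpace (Em × C) := FiniteDimensional.complete ℝ (Em × C)
  let S : M → (Em × C →L[ℝ] W) := fun x =>
    (B x).comp (ContinuousLinearMap.fst ℝ Em C) + (Φ x).comp (ContinuousLinearMap.snd ℝ Em C)
  have hS_apply : ∀ x (p : Em × C), S x p = B x p.1 + Φ x p.2 := fun x p => rfl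
  have hS : ContMDiffOn I 𝓘(ℝ, Em × C →L[ℝ] W) ∞ S U :=
    (hB.clm_comp contMDiffOn_const).add (hΦ.clm_comp contMDiffOn_const)
  have hinv : ∀ x ∈ U, (S x).IsInvertible := fun x hx =>
    isInvertible_of_bijective _ (by simpa only [funext (hS_apply x)] using hbij x hx)
  refine ⟨fun x => ((S x).inverse e).2, fun x hx => ?_, fun x hx => ⟨((S x).inverse e).1, ?_⟩⟩
  · have h1 : ContMDiffWithinAt I 𝓘(ℝ, W →L[ℝ] Em × C) ∞ (fun x => (S x).inverse) U x :=
      (hinv x hx).contDiffAt_map_inverse.comp_contMDiffWithinAt (hS x hx)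
    have h2 : ContMDiffWithinAt I 𝓘(ℝ, Em × C) ∞ (fun x => (S x).inverse e) U x :=
      h1.clm_apply contMDiffWithinAt_const
    exact (ContinuousLinearMap.snd ℝ Em C).contMDiff.contMDiffAt.comp_contMDiffWithinAt x h2
  · rw [← hS_apply]
    exact (hinv x hx).self_apply_inverse e

/-- **A complementary frame of complementary dimension completes frames of `T` to bases**: if
`B : Em → W` is injective with values in `T`, `Φ : C → W` is complementary to `T` and
`dim Em + dim C = dim W`, then `(y, c) ↦ B y + Φ c` is a linear isomorphism `Em × C ≅ W`.
[folklore] -/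
theorem IsComplementary.bijective_coprod [FiniteDimensional ℝ W] {T : Submodule ℝ W}
    {Φ : C →L[ℝ] W} (h : IsComplementary T Φ) {B : Em →L[ℝ] W} (hB : Injective B)
    (hBT : ∀ y, B y ∈ T) (hdim : finrank ℝ Em + finrank ℝ C = finrank ℝ W) :
    Bijective (B.coprod Φ) := by
  have hinj : Injective (B.coprod Φ) := by
    refine (injective_iff_map_eq_zero _).2 fun p hp => ?_
    rw [ContinuousLinearMap.coprod_apply] at hp
    have hΦ : Φ p.2 ∈ T := by
      rw [eq_neg_of_add_eq_zero_right hp]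
      exact T.neg_mem (hBT p.1)
    have h2 : p.2 = 0 := h _ hΦ
    rw [h2, map_zero, add_zero] at hp
    exact Prod.ext ((injective_iff_map_eq_zero _).1 hB _ hp) h2
  have hdim' : finrank ℝ (Em × C) = finrank ℝ W := by rw [finrank_prod, hdim]
  exact ⟨hinj, (LinearMap.injective_iff_surjective_of_finrank_eq_finrank hdim'
    (f := (B.coprod Φ : Em × C →ₗ[ℝ] W))).mp hinj⟩

end Coefficients

/-! ### Level spaces, the Gram map and the lifted frame -/

section Lift

variable {V : Type*} [NormedAddCommGroup V] [InnerProductSpace ℝ V] {m : ℕ}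

/-- The **Gram map** of `m` vectors `σ₀, …, σ_{m-1}`: `v ↦ (⟪σ_l, v⟫)_l : V → ℝᵐ`. [folklore] -/
def gramMap (σ : Fin m → V) : V →L[ℝ] (Fin m → ℝ) :=
  ∑ l, (ContinuousLinearMap.single ℝ (fun _ : Fin m => ℝ) l).comp (innerSL ℝ (σ l))

/-- `gramMap σ v l = ⟪σ l, v⟫`. [folklore] -/
@[simp]
theorem gramMap_apply (σ : Fin m → V) (v : V) (l : Fin m) : gramMap σ v l = ⟪σ l, v⟫ := by
  simp only [gramMap, _root_.sum_apply, Finset.sum_apply,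
    ContinuousLinearMap.comp_apply, innerSL_apply_apply, ContinuousLinearMap.single_apply]
  simp [Pi.single_apply]

/-- The Gram map depends continuously on the vectors. [folklore] -/
theorem continuous_gramMap {X : Type*} [TopologicalSpace X] {σ : Fin m → X → V}
    (hσ : ∀ l, Continuous (σ l)) : Continuous fun x => gramMap fun l => σ l x :=
  continuous_finsetSum _ fun l _ =>
    continuous_const.clm_comp ((innerSL ℝ (E := V)).continuous.comp (hσ l))

/-- The **lifted frame** of `L : V → ℝᵐ`: `v ↦ (v, L v) : V → V × ℝᵐ` (the graph of `L`).
[folklore] -/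
def liftFrame (L : V →L[ℝ] (Fin m → ℝ)) : V →L[ℝ] (V × (Fin m → ℝ)) :=
  ContinuousLinearMap.inl ℝ V (Fin m → ℝ) + (ContinuousLinearMap.inr ℝ V (Fin m → ℝ)).comp L

/-- `liftFrame L v = (v, L v)`. [folklore] -/
@[simp]
theorem liftFrame_apply (L : V →L[ℝ] (Fin m → ℝ)) (v : V) : liftFrame L v = (v, L v) := by
  simp [liftFrame]

/-- The lifted frame depends continuously on `L`. [folklore] -/
theorem continuous_liftFrame :
    Continuous (liftFrame : (V →L[ℝ] (Fin m → ℝ)) → V →L[ℝ] (V × (Fin m → ℝ))) :=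
  continuous_const.add (continuous_const.clm_comp continuous_id)

/-- **The lift of a framed subspace is complementary** (the stabilisation step of
Kervaire–Milnor's Lemma 3.3, `(τ ⊕ ε) ⊕ ν` trivial, in frame form): if `σ₀, …, σ_{m-1}` span
`T ⊆ V`, the graph frame `v ↦ (v, (⟪σ_l, v⟫)_l)` of the Gram map is complementary to `T × 0` in
`V × ℝᵐ` — a vector of `T` orthogonal to all the `σ_l` vanishes. [folklore] -/
theorem isComplementary_liftFrame_gramMap {T : Submodule ℝ V} {σ : Fin m → V}
    (hspan : T ≤ Submodule.span ℝ (range σ)) :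
    IsComplementary (T.prod ⊥) (liftFrame (gramMap σ)) := by
  intro v hv
  rw [liftFrame_apply, Submodule.mem_prod, Submodule.mem_bot] at hv
  have hvT : v ∈ T := hv.1
  have hv0 : gramMap σ v = 0 := hv.2
  have horth : ∀ l, ⟪σ l, v⟫ = 0 := fun l => by rw [← gramMap_apply σ v l, hv0, Pi.zero_apply]
  have hle : Submodule.span ℝ (range σ) ≤ (ℝ ∙ v)ᗮ := Submodule.span_le.mpr (by
    rintro _ ⟨l, rfl⟩
    exact Submodule.mem_orthogonal_singleton_iff_inner_left.mpr (horth l))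
  have hvv : ⟪v, v⟫ = 0 := Submodule.mem_orthogonal_singleton_iff_inner_left.mp (hle (hspan hvT))
  exact inner_self_eq_zero.mp hvv

/-- Basis family of `T × 0 ⊆ V × F` from a spanning independent family of `T`. [folklore] -/
theorem span_range_prodMk_zero_eq {F : Type*} [AddCommGroup F] [Module ℝ F] {T : Submodule ℝ V}
    {ι : Type*} {σ : ι → V} (h : Submodule.span ℝ (range σ) = T) :
    Submodule.span ℝ (range fun i => ((σ i, 0) : V × F)) = T.prod ⊥ := by
  rw [show (fun i => ((σ i, 0) : V × F)) = LinearMap.inl ℝ V F ∘ σ from rfl, Set.range_comp,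
    Submodule.span_image, h, Submodule.map_inl]

/-- Independence of `(σ i, 0)` from that of `σ`. [folklore] -/
theorem linearIndependent_prodMk_zero {F : Type*} [AddCommGroup F] [Module ℝ F] {ι : Type*}
    {σ : ι → V} (h : LinearIndependent ℝ σ) : LinearIndependent ℝ fun i => ((σ i, 0) : V × F) :=
  h.map' (LinearMap.inl ℝ V F) Submodule.ker_inl

end Lift

/-! ### Smoothing the lifted frame (compactness and smooth approximation) -/

section Smoothing

variable {EM : Type*} [NormedAddCommGroup EM] [NormedSpace ℝ EM] [FiniteDimensional ℝ EM]
  {HM : Type*} [TopologicalSpace HM] (I : ModelWithCorners ℝ EM HM)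
  {M : Type*} [TopologicalSpace M] [ChartedSpace HM M] [IsManifold I ∞ M] [CompactSpace M]
  [T2Space M]
  {V : Type*} [NormedAddCommGroup V] [InnerProductSpace ℝ V] [FiniteDimensional ℝ V] {m : ℕ}

/-- **A smooth complementary frame at the top level.** Let `T x ⊆ V` (`x ∈ M`, `M` a compact
manifold) be subspaces framed by a *continuous* pointwise independent family `σ₀, …, σ_{m-1}`.
Then there is a *smooth* family `L x : V → ℝᵐ` whose graph frames `v ↦ (v, L x v)` are
complementary to `T x × 0` in `V × ℝᵐ` for every `x`. Proof: the Gram maps of `σ` qualify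
(`isComplementary_liftFrame_gramMap`) but are only continuous; complementarity is an open
condition (`isOpen_setOf_isComplementary`), so by compactness (`generalized_tube_lemma`) it
survives perturbations of `L` of size `< ε` uniformly in `x`, and a smooth `ε`-approximation of
the Gram maps (`Continuous.exists_contMDiff_approx`) does it. [folklore] -/
theorem exists_contMDiff_isComplementary_liftFrame {T : M → Submodule ℝ V} {σ : Fin m → M → V}
    (hσc : ∀ l, Continuous (σ l)) (hσli : ∀ x, LinearIndependent ℝ fun l => σ l x)
    (hσT : ∀ x, Submodule.span ℝ (range fun l => σ l x) = T x) :
    ∃ L : M → (V →L[ℝ] (Fin m → ℝ)), ContMDiff I 𝓘(ℝ, V →L[ℝ] (Fin m → ℝ)) ∞ L ∧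
      ∀ x, IsComplementary ((T x).prod ⊥) (liftFrame (L x)) := by
  let P := V →L[ℝ] (Fin m → ℝ)
  let L₀ : M → P := fun x => gramMap fun l => σ l x
  have hL₀ : Continuous L₀ := continuous_gramMap hσc
  -- the open set of good perturbations
  let O : Set (M × P) := {q | IsComplementary ((T q.1).prod ⊥) (liftFrame (L₀ q.1 + q.2))}
  have hO : IsOpen O := by
    refine isOpen_setOf_isComplementary (X := M × P) (T := fun q => (T q.1).prod ⊥)
      (s := fun l q => ((σ l q.1, 0) : V × (Fin m → ℝ)))
      (fun l => ((hσc l).comp continuous_fst).prodMk continuous_const)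
      (fun q => linearIndependent_prodMk_zero (hσli q.1))
      (fun q => span_range_prodMk_zero_eq (hσT q.1)) (Module.finBasis ℝ V) ?_
    exact continuous_liftFrame.comp ((hL₀.comp continuous_fst).add continuous_snd)
  have hsub : (univ : Set M) ×ˢ ({0} : Set P) ⊆ O := by
    rintro ⟨x, A⟩ ⟨-, hA⟩
    rw [mem_singleton_iff] at hA
    subst hA
    change IsComplementary ((T x).prod ⊥) (liftFrame (L₀ x + 0))
    rw [add_zero]
    exact isComplementary_liftFrame_gramMap (hσT x).ge
  obtain ⟨u, v, -, hv, hu, h0v, huv⟩ :=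
    generalized_tube_lemma isCompact_univ isCompact_singleton hO hsub
  obtain ⟨ε, hε, hball⟩ := Metric.isOpen_iff.mp hv 0 (h0v rfl)
  -- smooth `ε`-approximation of the Gram maps
  obtain ⟨g, hg, -⟩ := hL₀.exists_contMDiff_approx I ⊤ continuous_const fun _ => hε
  refine ⟨g, g.contMDiff, fun x => ?_⟩
  have hmem : (x, g x - L₀ x) ∈ O := by
    refine huv ⟨hu (mem_univ x), hball ?_⟩
    rw [mem_ball_zero_iff, ← dist_eq_norm]
    exact hg x
  have : IsComplementary ((T x).prod ⊥) (liftFrame (L₀ x + (g x - L₀ x))) := hmem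
  rwa [add_sub_cancel] at this

end Smoothing

end Literature.Topology.FourManifolds
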